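import Summits.QuantumFields.QCD.Theorems.ExtinctionBuildsQCD.Negative.WeylWindow
import Summits.QuantumFields.QCD.Theorems.ExtinctionBuildsQCD.Negative.ExtinctIntegrable
import Summits.QuantumFields.QCD.Theorems.ExtinctionBuildsQCD.Negative.VolumeLever

/-!
# `ExtinctionBuildsQCD` (crux stmt-QuantumFields-8968) — negative-side support, cycle 3 (3/4):
# the COERCIVITY CEILING `c ≤ 1`

Extract of §6d of the standing disprover's work file (cdisprove cycle 3, 2026-08-16), on top of
`Negative/WeylWindow.lean` (pointwise domination of TIGHT by EXTINCT), `Negative/ExtinctIntegrable.lean`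
(integrability) and `Negative/VolumeLever.lean` (`tightRatio`).

* `extinctRatio`, `extinct_iff_extinctRatio` (definitional), `tightRatio_le_extinctRatio`.
* **`c_le_one_of_extinct_tight`** — for ANY regularisation, threshold `M₀ ≥ 0` and `N_f ≥ 1`: if every mass tuple above
  `M₀` is EXTINCT with window constant `c` and TIGHT, then `c ≤ 1`. Hence `SDHyp.c_le_one`, `not_sdHyp_with_one_lt`
  (the natural strengthening "`SD` with `c > 1`" of the sibling crux `WindowExtinction` is UNSATISFIABLE, so the bridge
  `ExtinctionBuildsQCD` restricted to that hypothesis is vacuously true) and `windowExtinction_c_le_one`. MEANING: TIGHT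
  makes the line critical (near-zero modes of `H_W(m_f(k))` within `a_k(m_f+M)/Z_k` on average, `Negative/TwoSidedPin.lean`),
  so the statistical Vafa–Witten coercivity `‖(D_W + m_f(k))⁻¹‖ ≤ Z_k/(c a_k m_f)` the bridge may extract from its
  hypothesis never beats the bare distance to the line. No scaling hypothesis is used.
References: Vafa–Witten, Nucl. Phys. B 234 (1984) 173; Del Debbio–Giusti–Lüscher–Petronzio–Tantalo, JHEP 02 (2006) 011.
-/

noncomputable section

namespace Summit.QuantumFields.QCD.Theorems.ExtinctionBuildsQCD.Negative

open scoped BigOperators Topology Classical MeasureTheory Matrix ComplexConjugate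
open Filter MeasureTheory Matrix
open Literature.MathematicalPhysics.QuantumLattice Literature.MathematicalPhysics.QuantumFieldTheory
  Literature.Probability.LatticeModels
open Summit.QuantumFields.QCD.Theses.SpectralDefectExtinction

/-! ## §6d The coercivity ceiling `c ≤ 1` -/

section Ceiling

variable {Nf : ℕ}

/-- The EXTINCT ratio of witness data `(reg, c)` at step `k`, mass tuple `m`, on the torus of half-side
`S` (EXTINCT itself is `extinct_iff_extinctRatio`; verbatim from the route file). -/
noncomputable def extinctRatio (reg : QCDRegularisation Nf) (c : ℝ) (k S : ℕ) (m : Fin Nf → ℝ) : ℝ :=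
  (∫ U, ((∑ f : Fin Nf, ((Multiset.countP (fun z : ℂ => z.im = 0 ∧ z.re < -(reg.mcrit k + reg.a k * m f / reg.Zm k)) (wilsonDirac (fundamentalRep (Fin 3)) U 0 1).charpoly.roots : ℝ) + (Multiset.countP (fun z : ℂ => |z.re| < c * (reg.a k * m f / reg.Zm k)) (spinorLift gammaFive * wilsonDirac (fundamentalRep (Fin 3)) U (reg.mcrit k + reg.a k * m f / reg.Zm k) 1).charpoly.roots : ℝ)))) * ∏ f : Fin Nf, ‖fermionDet (wilsonDirac (fundamentalRep (Fin 3)) U (reg.mcrit k + reg.a k * m f / reg.Zm k) 1)‖ ∂(wilsonMeasure (d := 4) (L := 2 * S + 1) (fundamentalRep (Fin 3)) (reg.β k))) / (∫ U, ∏ f : Fin Nf, ‖fermionDet (wilsonDirac (fundamentalRep (Fin 3)) U (reg.mcrit k + reg.a k * m f / reg.Zm k) 1)‖ ∂(wilsonMeasure (d := 4) (L := 2 * S + 1) (fundamentalRep (Fin 3)) (reg.β k)))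

/-- EXTINCT is "for every `ε > 0`, eventually in `k`, on every torus `S ≥ L_k` the ratio is
`≤ ε((2S+1)/(2L_k+1))⁴`" (definitional). -/
theorem extinct_iff_extinctRatio (reg : QCDRegularisation Nf) (c : ℝ) (m : Fin Nf → ℝ) :
    Extinct Nf reg c m ↔ ∀ ε : ℝ, 0 < ε → ∀ᶠ k : ℕ in Filter.atTop, ∀ S : ℕ, reg.L k ≤ S →
      extinctRatio reg c k S m ≤ ε * ((2 * S + 1 : ℝ) / (2 * reg.L k + 1)) ^ 4 :=
  Iff.rfl

/-- **EXTINCT is monotone in the window constant**: for non-negative masses a smaller `c` clears a smaller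
window, so `extinctRatio` decreases with `c` — the `∃ c > 0` of `SD` may always be taken small; together with the
ceiling below, WLOG `c ∈ (0, 1]`. -/
theorem extinctRatio_mono (reg : QCDRegularisation Nf) {c c' : ℝ} (hc : c' ≤ c) (k S : ℕ) {m : Fin Nf → ℝ}
    (hm : ∀ f, 0 ≤ m f) : extinctRatio reg c' k S m ≤ extinctRatio reg c k S m := by
  unfold extinctRatio
  refine div_le_div_of_nonneg_right ?_
    (integral_nonneg fun U => Finset.prod_nonneg fun f _ => norm_nonneg _)
  refine integral_mono_of_nonneg (Eventually.of_forall fun U => ?_)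
    (integrable_extinctIntegrand reg c k m (reg.β k)) (Eventually.of_forall fun U => ?_)
  · exact mul_nonneg (Finset.sum_nonneg fun f _ => by positivity) (Finset.prod_nonneg fun f _ => norm_nonneg _)
  · refine mul_le_mul_of_nonneg_right (Finset.sum_le_sum fun f _ => add_le_add le_rfl ?_)
      (Finset.prod_nonneg fun f _ => norm_nonneg _)
    have hw : c' * (reg.a k * m f / reg.Zm k) ≤ c * (reg.a k * m f / reg.Zm k) :=
      mul_le_mul_of_nonneg_right hc (div_nonneg (mul_nonneg (reg.a_pos k).le (hm f)) (reg.Zm_pos k).le)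
    exact_mod_cast countP_le_countP_of_imp (p := fun z : ℂ => |z.re| < c' * (reg.a k * m f / reg.Zm k))
      (q := fun z : ℂ => |z.re| < c * (reg.a k * m f / reg.Zm k)) _ fun z hz => lt_of_lt_of_le hz hw

/-- `Extinct` with constant `c` implies `Extinct` with any smaller constant (non-negative masses). -/
theorem Extinct.mono (reg : QCDRegularisation Nf) {c c' : ℝ} (hc : c' ≤ c) {m : Fin Nf → ℝ}
    (hm : ∀ f, 0 ≤ m f) (h : Extinct Nf reg c m) : Extinct Nf reg c' m := by
  rw [extinct_iff_extinctRatio] at h ⊢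
  intro ε hε
  filter_upwards [h ε hε] with k hk S hS
  exact (extinctRatio_mono reg hc k S hm).trans (hk S hS)

/-- **TIGHT ≤ EXTINCT whenever one flavour's Weyl window fits inside its coercivity window.** For any
witness data, step `k`, torus half-side `S`, non-negative masses, probe parameter `M ≥ 0` and a flavour
`f₀` with `m_{f₀} + M < c·m_{f₀}`: the TIGHT ratio on the torus `(2S+1)⁴` is at most the EXTINCT ratio
there (pointwise domination `tightIntegrand_mul_le_extinctIntegrand_mul`, integrability of the EXTINCT
integrand, common denominator). -/
theorem tightRatio_le_extinctRatio (reg : QCDRegularisation Nf) (c : ℝ) (k S : ℕ) {m : Fin Nf → ℝ}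
    {M : ℝ} (f₀ : Fin Nf) (hm : 0 ≤ m f₀) (hM : 0 ≤ M) (hwin : m f₀ + M < c * m f₀) :
    tightRatio reg k S m M ≤ extinctRatio reg c k S m := by
  unfold tightRatio extinctRatio
  refine div_le_div_of_nonneg_right ?_
    (integral_nonneg fun U => Finset.prod_nonneg fun f _ => norm_nonneg _)
  refine integral_mono_of_nonneg (Eventually.of_forall fun U => ?_)
    (integrable_extinctIntegrand reg c k m (reg.β k)) (Eventually.of_forall fun U => ?_)
  · exact mul_nonneg (abs_nonneg _) (Finset.prod_nonneg fun f _ => norm_nonneg _)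
  · exact tightIntegrand_mul_le_extinctIntegrand_mul U reg c k m M f₀ hm hM hwin

/-- **THE COERCIVITY CEILING.** For ANY regularisation `reg`, threshold `M₀ ≥ 0`, window constant `c`
and at least one flavour: if every mass tuple above `M₀` is EXTINCT (with `c`) and TIGHT, then `c ≤ 1`.
Proof: were `c > 1`, take all masses `= K` with `(c−1)K > M₀+1` and the probe `M = M₀+1`; eventually in
`k`, TIGHT gives `1 ≤ tightRatio`, EXTINCT at `ε = 1/2` on the scheme torus gives `extinctRatio ≤ 1/2`,
and `tightRatio ≤ extinctRatio`. MEANING: TIGHT makes the line critical (near-zero modes of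
`H_W(m_f(k))` within `a_k(m_f+M)/Z_k`, mean `≥ 1−ε`), so the coercivity window EXTINCT(b) can clear is at
most the bare distance `a_k m_f/Z_k` to the line — the statistical Vafa–Witten bound the bridge extracts,
`‖(D_W + m_f(k))⁻¹‖ ≤ Z_k/(c a_k m_f)` off the defect gas, never has `c > 1`. -/
theorem c_le_one_of_extinct_tight (reg : QCDRegularisation Nf) {M₀ c : ℝ} (hM₀ : 0 ≤ M₀)
    (f₀ : Fin Nf) (h : ∀ m : Fin Nf → ℝ, (∀ f, M₀ < m f) → Extinct Nf reg c m ∧ Tight Nf reg M₀ m) :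
    c ≤ 1 := by
  by_contra hc
  push Not at hc
  have hc1 : 0 < c - 1 := by linarith
  -- masses `K` with `(c - 1) K > M₀ + 1`, probe `M = M₀ + 1`
  set K : ℝ := (M₀ + 2) / (c - 1) + (M₀ + 1) with hK
  have hKdiv : (c - 1) * ((M₀ + 2) / (c - 1)) = M₀ + 2 := by
    rw [mul_comm]; exact div_mul_cancel₀ (M₀ + 2) hc1.ne'
  have hK₀ : M₀ < K := by
    have : 0 ≤ (M₀ + 2) / (c - 1) := by positivity
    linarith
  have hKnn : 0 ≤ K := by linarith
  have hwin : K + (M₀ + 1) < c * K := by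
    have h2 : 0 ≤ (c - 1) * (M₀ + 1) := mul_nonneg hc1.le (by linarith)
    have h3 : c * K = K + (c - 1) * ((M₀ + 2) / (c - 1)) + (c - 1) * (M₀ + 1) := by rw [hK]; ring
    rw [h3, hKdiv]
    linarith
  obtain ⟨hE, hT⟩ := h (fun _ => K) fun _ => hK₀
  have hE' := hE (1 / 2) (by norm_num)
  have hT' := hT (M₀ + 1) (by linarith)
  obtain ⟨k, hEk, hTk⟩ := (hE'.and hT').exists
  have hEk' : extinctRatio reg c k (reg.L k) (fun _ => K) ≤
      1 / 2 * ((2 * (reg.L k : ℕ) + 1 : ℝ) / (2 * reg.L k + 1)) ^ 4 := hEk (reg.L k) le_rfl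
  have hTk' : 1 ≤ tightRatio reg k (reg.L k) (fun _ => K) (M₀ + 1) := hTk
  have hone : ((2 * (reg.L k : ℕ) + 1 : ℝ) / (2 * reg.L k + 1)) = 1 := div_self (by positivity)
  rw [hone, one_pow, mul_one] at hEk'
  have hle := tightRatio_le_extinctRatio reg c k (reg.L k) (m := fun _ => K) (M := M₀ + 1) f₀ hKnn
    (by linarith) hwin
  linarith

/-- **Every `SD` witness has window constant `c ≤ 1`** (`N_f ≥ 1`). -/
theorem SDHyp.c_le_one (hNf : 0 < Nf) {reg : QCDRegularisation Nf} {M₀ c : ℝ} (hM₀ : 0 ≤ M₀)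
    (h : ∀ m : Fin Nf → ℝ, (∀ f, M₀ < m f) → Extinct Nf reg c m ∧ Tight Nf reg M₀ m) : c ≤ 1 :=
  c_le_one_of_extinct_tight reg hM₀ ⟨0, hNf⟩ h

/-- **The natural strengthening "`SD` with `c > 1`" is unsatisfiable** for every `N_f ≥ 1` (in
particular `WindowExtinction` with `1 < c` in place of `0 < c` is FALSE, and the bridge with that
hypothesis is vacuously true): EXTINCT(b)'s window can never be wider than the bare distance to a TIGHT
line. No scaling hypothesis is used. -/
theorem not_sdHyp_with_one_lt (hNf : 0 < Nf) :
    ¬ ∃ reg : QCDRegularisation Nf, ∃ M₀ : ℝ, 0 ≤ M₀ ∧ ∃ c : ℝ, 1 < c ∧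
      ∀ m : Fin Nf → ℝ, (∀ f, M₀ < m f) → Extinct Nf reg c m ∧ Tight Nf reg M₀ m := by
  rintro ⟨reg, M₀, hM₀, c, hc, h⟩
  have := SDHyp.c_le_one hNf hM₀ h
  linarith

/-- Reading for the sibling crux: any witness of `WindowExtinction` at `N_f ∈ {2,3}` has `c ≤ 1`. -/
theorem windowExtinction_c_le_one (h : WindowExtinction) {Nf : ℕ} (hNf : Nf = 2 ∨ Nf = 3) :
    ∃ reg : QCDRegularisation Nf, reg.HasMassScaling ∧ (reg.scheme 0 0 0).HasAsymptoticScaling ∧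
      ∃ M₀ : ℝ, 0 ≤ M₀ ∧ ∃ c : ℝ, 0 < c ∧ c ≤ 1 ∧ ∀ m : Fin Nf → ℝ, (∀ f, M₀ < m f) →
        Extinct Nf reg c m ∧ Tight Nf reg M₀ m := by
  -- buildfix 2026-08-19: `WindowExtinction` was restated (route rev 9, SD⁺: volume cap + branch clause
  -- inserted after the asymptotic-scaling conjunct); the two new conjuncts are discarded here.
  -- TIGHT was strengthened to the extensive form `max 1 (η (a_k(2L_k+1))²) ≤ ratio`, which implies
  -- the fixed-cutoff `Tight` (`1 ≤ ratio`) recorded in this file; EXTINCT is textually unchanged.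
  obtain ⟨reg, h1, h2, -, -, M₀, hM₀, c, hc, h⟩ := h Nf hNf
  have hNf' : 0 < Nf := by rcases hNf with rfl | rfl <;> norm_num
  have h' : ∀ m : Fin Nf → ℝ, (∀ f, M₀ < m f) → Extinct Nf reg c m ∧ Tight Nf reg M₀ m := by
    intro m hm
    obtain ⟨hE, η, _, hT⟩ := h m hm
    refine ⟨hE, fun M hM => ?_⟩
    filter_upwards [hT M hM] with k hk
    exact le_trans (le_max_left _ _) hk
  exact ⟨reg, h1, h2, M₀, hM₀, c, hc, SDHyp.c_le_one hNf' hM₀ h', h'⟩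

end Ceiling


end Summit.QuantumFields.QCD.Theorems.ExtinctionBuildsQCD.Negative

end
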